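import Literature.AlgebraicGeometry.ModuliOfAbelianVarieties.SiegelCanonicalModel
import Literature.AlgebraicGeometry.ShimuraVarieties.UnitaryAuxiliaryComplexStructure
import HarnessLib

/-!
# The CM structure of an `H^j`-orthogonal frame of the auxiliary symplectic module `W₀ ⊕ V_M`

[Deligne1971TravauxShimura] 4.18 / [Deligne1979ShimuraVarieties] Prop. 2.3.10: for the auxiliary symplectic `ℚ`-space
`(W₀ ⊕ V_M, ψ)` of the unitary datum (`W₀ = M`, `V_M = M³` with the `M`-sesquilinear Gram matrix `diag(ξ₀, ξ·H^j)`,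
★ `auxGram`, `auxForm`) and a symplectic frame `β : M^{1⊕3} ≃ ℚ^{2g}` (★ `SymplecticFrame`), every `H^j`-ORTHOGONAL
`M`-frame `B = (b₁ | b₂ | b₃) ∈ GL₃(M)` of `V_M` (`ᵗc(B)·H^j·B` diagonal) makes `ℚ^{2g}` a free module of rank one over the
CM algebra `F = M × M × M × M = M^{Fin 1 ⊕ Fin 3}` — `x = (x₀; x₁, x₂, x₃)` acts on `W₀` by `x₀` and on the line `M·b_k` by
`x_k` — and this action is `ψ_δ`-self-adjoint for complex conjugation on every factor (orthogonality of the frame).  This is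
the CM structure (★ `CMStructure g δ (Fin 1 ⊕ Fin 3) (fun _ => M)`) through which the special points of the unitary
Shimura variety lying on a LINE `ℓ = M·b₃` factor ([Deligne1971TravauxShimura] 5.11–5.12).

Main result: `exists_cmStructure_of_orthogonal`.
-/

noncomputable section

open Matrix NumberField

namespace Literature.AlgebraicGeometry.ShimuraVarieties.UnitaryCanonicalModel.Aux

open Literature.AlgebraicGeometry.ModuliOfAbelianVarieties

section FrameAlgebra

variable {M : Type} [Field M]

/-- `x ↦ P·diag(x)·P⁻¹` («multiply the `p`-th frame vector by `x p`», as an `M`-linear map of `M^{1⊕3}`) is multiplicative. [cite: Deligne1971TravauxShimura, 4.18 p. 150] -/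
theorem frameDiag_mulVecLin_mul (P : GL (Fin 1 ⊕ Fin 3) M) (x y : Fin 1 ⊕ Fin 3 → M) :
    Matrix.mulVecLin (P.val * Matrix.diagonal (x * y) * (P⁻¹).val) = Matrix.mulVecLin (P.val * Matrix.diagonal x * (P⁻¹).val) ∘ₗ Matrix.mulVecLin (P.val * Matrix.diagonal y * (P⁻¹).val) := by
  refine LinearMap.ext fun v => ?_
  rw [LinearMap.comp_apply, Matrix.mulVecLin_apply, Matrix.mulVecLin_apply, Matrix.mulVecLin_apply, Matrix.mulVec_mulVec]
  congr 1
  rw [show Matrix.diagonal (x * y) = Matrix.diagonal x * Matrix.diagonal y from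
    (Matrix.diagonal_mul_diagonal x y).symm]
  simp only [Matrix.mul_assoc]
  rw [← Matrix.mul_assoc (P⁻¹).val P.val, Units.inv_mul, Matrix.one_mul]

/-- `Matrix.mulVecLin (P.val * Matrix.diagonal 1 * (P⁻¹).val) = id`. [cite: Deligne1971TravauxShimura, 4.18 p. 150] -/
theorem frameDiag_mulVecLin_one (P : GL (Fin 1 ⊕ Fin 3) M) : Matrix.mulVecLin (P.val * Matrix.diagonal 1 * (P⁻¹).val) = LinearMap.id := by
  refine LinearMap.ext fun v => ?_
  rw [Matrix.mulVecLin_apply, Matrix.diagonal_one', Matrix.mul_one, Units.mul_inv, Matrix.one_mulVec, LinearMap.id_apply]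

/-- `x ↦ P·diag(x)·P⁻¹` is additive. [cite: Deligne1971TravauxShimura, 4.18 p. 150] -/
theorem frameDiag_mulVecLin_add (P : GL (Fin 1 ⊕ Fin 3) M) (x y : Fin 1 ⊕ Fin 3 → M) :
    Matrix.mulVecLin (P.val * Matrix.diagonal (x + y) * (P⁻¹).val) = Matrix.mulVecLin (P.val * Matrix.diagonal x * (P⁻¹).val) + Matrix.mulVecLin (P.val * Matrix.diagonal y * (P⁻¹).val) := by
  refine LinearMap.ext fun v => ?_
  rw [LinearMap.add_apply, Matrix.mulVecLin_apply, Matrix.mulVecLin_apply, Matrix.mulVecLin_apply, ← Matrix.add_mulVec,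
    ← Matrix.add_mul, ← Matrix.mul_add, Matrix.diagonal_add]
  rfl

/-- `Matrix.mulVecLin (P.val * Matrix.diagonal 0 * (P⁻¹).val) = 0`. [cite: Deligne1971TravauxShimura, 4.18 p. 150] -/
theorem frameDiag_mulVecLin_zero (P : GL (Fin 1 ⊕ Fin 3) M) : Matrix.mulVecLin (P.val * Matrix.diagonal 0 * (P⁻¹).val) = 0 := by
  refine LinearMap.ext fun v => ?_
  rw [Matrix.mulVecLin_apply, Matrix.diagonal_zero', Matrix.mul_zero, Matrix.zero_mul, Matrix.zero_mulVec,
    LinearMap.zero_apply]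

/-- Scalars act by scalars: `P·diag(r,…,r)·P⁻¹ = r`. [cite: Deligne1971TravauxShimura, 4.18 p. 150] -/
theorem frameDiag_mulVecLin_const (P : GL (Fin 1 ⊕ Fin 3) M) (r : M) (v : Fin 1 ⊕ Fin 3 → M) :
    Matrix.mulVecLin (P.val * Matrix.diagonal (fun _ => r) * (P⁻¹).val) v = r • v := by
  have h : (Matrix.diagonal fun _ : Fin 1 ⊕ Fin 3 => r) = r • (1 : Matrix (Fin 1 ⊕ Fin 3) (Fin 1 ⊕ Fin 3) M) := by
    ext i k
    simp [Matrix.diagonal_apply, Matrix.one_apply, Matrix.smul_apply]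
  rw [Matrix.mulVecLin_apply, h, Matrix.mul_smul, Matrix.mul_one, Matrix.smul_mul, Units.mul_inv, Matrix.smul_mulVec,
    Matrix.one_mulVec]

/-- The frame vectors are eigenvectors: `(P·diag(x)·P⁻¹)(m·P e_p) = (x_p m)·P e_p`.
[cite: Deligne1971TravauxShimura, 4.18 p. 150] -/
theorem frameDiag_mulVecLin_apply_frameVec (P : GL (Fin 1 ⊕ Fin 3) M) (x : Fin 1 ⊕ Fin 3 → M)
    (p : Fin 1 ⊕ Fin 3) (m : M) :
    Matrix.mulVecLin (P.val * Matrix.diagonal x * (P⁻¹).val) (m • P.val *ᵥ Pi.single p 1) = (x p * m) • P.val *ᵥ Pi.single p 1 := by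
  have hs : x p • (Pi.single p (1 : M) : Fin 1 ⊕ Fin 3 → M) = Pi.single p (x p) := by
    rw [← Pi.single_smul', smul_eq_mul, mul_one]
  rw [Matrix.mulVecLin_apply, Matrix.mulVec_smul, Matrix.mulVec_mulVec, Matrix.mul_assoc, Matrix.mul_assoc,
    Units.inv_mul, Matrix.mul_one, ← Matrix.mulVec_mulVec, Matrix.diagonal_mulVec_single, mul_one, ← hs,
    Matrix.mulVec_smul, smul_smul, mul_comm m]

/-- The frame vectors are nonzero. [cite: Deligne1971TravauxShimura, 4.18 p. 150] -/
theorem frameVec_ne_zero (P : GL (Fin 1 ⊕ Fin 3) M) (p : Fin 1 ⊕ Fin 3) : P.val *ᵥ Pi.single p (1 : M) ≠ 0 := by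
  intro h
  have h1 : (P⁻¹).val *ᵥ (P.val *ᵥ Pi.single p (1 : M)) = Pi.single p 1 := by
    rw [Matrix.mulVec_mulVec, Units.inv_mul, Matrix.one_mulVec]
  rw [h, Matrix.mulVec_zero] at h1
  have h2 := congrFun h1 p
  simp at h2

/-! ### The adjoint identity `ψ(P·diag(x)·P⁻¹ v, w) = ψ(v, P·diag(x̄)·P⁻¹ w)` for an orthogonal frame -/

/-- A diagonal matrix commutes with a matrix whose off-diagonal entries vanish. [cite: Deligne1971TravauxShimura, 4.18 p. 150] -/
private theorem diagonal_mul_comm_of_offDiag {n : Type} [Fintype n] [DecidableEq n] (d : n → M) (Δ : Matrix n n M)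
    (hΔ : ∀ i k, i ≠ k → Δ i k = 0) : Matrix.diagonal d * Δ = Δ * Matrix.diagonal d := by
  ext i k
  rw [Matrix.diagonal_mul, Matrix.mul_diagonal]
  by_cases hik : i = k
  · subst hik; exact mul_comm _ _
  · rw [hΔ i k hik, mul_zero, zero_mul]

/-- **Key matrix identity.** For a frame `P` whose Gram matrix `Δ = ᵗc(P)·G·P` in a sesquilinear form with matrix `G`
(`c` a ring endomorphism applied entrywise) has no off-diagonal entries: `ᵗc(P·diag(x)·P⁻¹)·G = G·(P·diag(c∘x)·P⁻¹)` —
the adjoint of «multiply the `p`-th frame vector by `x_p`» is «multiply it by `c(x_p)`».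
[cite: Deligne1971TravauxShimura, 4.18 p. 150] -/
theorem transpose_map_mul_gram_eq {F : Type} [FunLike F M M] [RingHomClass F M M] (c : F)
    (G : Matrix (Fin 1 ⊕ Fin 3) (Fin 1 ⊕ Fin 3) M) (P : GL (Fin 1 ⊕ Fin 3) M)
    (hΔ : ∀ i k, i ≠ k → ((P.val.map c)ᵀ * G * P.val) i k = 0) (x : Fin 1 ⊕ Fin 3 → M) :
    ((P.val * Matrix.diagonal x * (P⁻¹).val).map c)ᵀ * G =
      G * (P.val * Matrix.diagonal (fun i => c (x i)) * (P⁻¹).val) := by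
  have hPinvP : ((P⁻¹).val.map c) * (P.val.map c) = 1 := by
    rw [← Matrix.map_mul, Units.inv_mul, Matrix.map_one c (map_zero c) (map_one c)]
  have hPPinv : (P.val.map c) * ((P⁻¹).val.map c) = 1 := by
    rw [← Matrix.map_mul, Units.mul_inv, Matrix.map_one c (map_zero c) (map_one c)]
  -- the two invertible factors we cancel
  have hU : IsUnit (P.val.map c)ᵀ := by
    rw [Matrix.isUnit_transpose]
    exact ⟨⟨P.val.map c, (P⁻¹).val.map c, hPPinv, hPinvP⟩, rfl⟩
  have hV : IsUnit P.val := Units.isUnit P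
  have hD : (Matrix.diagonal x).map c = Matrix.diagonal (fun i => c (x i)) := Matrix.diagonal_map (map_zero c)
  refine hU.mul_left_cancel (hV.mul_right_cancel ?_)
  have hcomm := diagonal_mul_comm_of_offDiag (fun i => c (x i)) _ hΔ
  calc (P.val.map c)ᵀ * (((P.val * Matrix.diagonal x * (P⁻¹).val).map c)ᵀ * G) * P.val
      = (((P.val * Matrix.diagonal x * (P⁻¹).val).map c) * P.val.map c)ᵀ * G * P.val := by
        rw [Matrix.transpose_mul _ (P.val.map c)]
        simp only [Matrix.mul_assoc]
    _ = (P.val.map c * Matrix.diagonal (fun i => c (x i)))ᵀ * G * P.val := by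
        rw [Matrix.map_mul, Matrix.map_mul, hD, Matrix.mul_assoc (P.val.map c * _), hPinvP, Matrix.mul_one]
    _ = Matrix.diagonal (fun i => c (x i)) * ((P.val.map c)ᵀ * G * P.val) := by
        rw [Matrix.transpose_mul, Matrix.diagonal_transpose]
        simp only [Matrix.mul_assoc]
    _ = ((P.val.map c)ᵀ * G * P.val) * Matrix.diagonal (fun i => c (x i)) := hcomm
    _ = (P.val.map c)ᵀ * (G * (P.val * Matrix.diagonal (fun i => c (x i)) * (P⁻¹).val)) * P.val := by
        simp only [Matrix.mul_assoc]
        rw [Units.inv_mul, Matrix.mul_one]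

/-- `ᵗ(A u)·y = ᵗu·(ᵗA y)`. [cite: Deligne1971TravauxShimura, 4.18 p. 150] -/
private theorem mulVec_dotProduct_eq_dotProduct_transpose_mulVec {n : Type} [Fintype n]
    (A : Matrix n n M) (u y : n → M) : (A *ᵥ u) ⬝ᵥ y = u ⬝ᵥ (Aᵀ *ᵥ y) := by
  rw [Matrix.dotProduct_mulVec, Matrix.vecMul_transpose]

end FrameAlgebra

section OrthogonalFrame

variable {L : Type} [Field L] {M : Type} [Field M] [NumberField M] [IsCMField M] {j : L →+* M}
  {H : Matrix (Fin 3) (Fin 3) L} {ξ₀ ξ : M} {g : ℕ} {δ : Fin g → ℕ}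

/-- `ψ(A v, w) = ψ(v, A' w)` from the matrix identity `ᵗc(A)·G = G·A'`, for the trace form `ψ = Tr_{M/ℚ}(ᵗc(·)·G·(·))`
(★ `auxForm`, `G =` ★ `auxGram`). [cite: Deligne1979ShimuraVarieties, Prop. 2.3.10 (PDF p. 32)] -/
theorem auxForm_mulVec_eq_of_transpose_map_mul (A A' : Matrix (Fin 1 ⊕ Fin 3) (Fin 1 ⊕ Fin 3) M)
    (h : (A.map (IsCMField.complexConj M))ᵀ * auxGram M j H ξ₀ ξ = auxGram M j H ξ₀ ξ * A')
    (v w : (Fin 1 ⊕ Fin 3) → M) :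
    auxForm M j H ξ₀ ξ (A *ᵥ v) w = auxForm M j H ξ₀ ξ v (A' *ᵥ w) := by
  rw [auxForm_apply, auxForm_apply]
  congr 1
  have hc : (fun i => IsCMField.complexConj M ((A *ᵥ v) i)) =
      A.map (IsCMField.complexConj M) *ᵥ fun i => IsCMField.complexConj M (v i) := by
    funext i
    simp [Matrix.mulVec, dotProduct, map_sum, map_mul]
  rw [hc, mulVec_dotProduct_eq_dotProduct_transpose_mulVec, Matrix.mulVec_mulVec, h, ← Matrix.mulVec_mulVec]

/-- **The CM structure of an `H^j`-orthogonal frame** ([Deligne1971TravauxShimura] 4.18, [Deligne1979ShimuraVarieties]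
Prop. 2.3.10): for a symplectic frame `β : (W₀ ⊕ V_M, ψ) ≃ (ℚ^{2g}, ψ_δ)` (★ `SymplecticFrame`) and an `M`-frame
`B ∈ GL₃(M)` of `V_M` with `ᵗc(B)·H^j·B` DIAGONAL, there is a CM structure (★ `CMStructure`) of the CM algebra
`F = M^{Fin 1 ⊕ Fin 3}` on `(ℚ^{2g}, ψ_δ)` in which `x = (x₀; x₁, x₂, x₃) ∈ F` acts — transported through `β` — on the line
`M·e₀ = W₀` by `x₀` and on the line `M·b_k ⊂ V_M` by `x_k` (`diag(1, B)·e_p` the `p`-th frame vector): `ψ_δ`-self-adjointness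
for complex conjugation on every factor is the orthogonality of the frame, `Σ_p [M:ℚ] = 4[M:ℚ] = 2g` is read off `β`.
[cite: Deligne1971TravauxShimura, 4.18 p. 150] [cite: Deligne1979ShimuraVarieties, Prop. 2.3.10 (PDF p. 32)] -/
theorem exists_cmStructure_of_orthogonal (F : SymplecticFrame M j H ξ₀ ξ g δ) (B : GL (Fin 3) M)
    (hB : ∀ i k : Fin 3, i ≠ k →
      (((B : Matrix (Fin 3) (Fin 3) M).map (IsCMField.complexConj M))ᵀ * H.map j *
        (B : Matrix (Fin 3) (Fin 3) M)) i k = 0) :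
    ∃ c : CMStructure g δ (Fin 1 ⊕ Fin 3) (fun _ => M),
      ∀ (x : Fin 1 ⊕ Fin 3 → M) (p : Fin 1 ⊕ Fin 3) (m : M),
        c.act x (F.β (m • (blockGL M (1, B)).val *ᵥ Pi.single p 1)) =
          F.β ((x p * m) • (blockGL M (1, B)).val *ᵥ Pi.single p 1) := by
  classical
  set P : GL (Fin 1 ⊕ Fin 3) M := blockGL M (1, B) with hP
  -- (1) the frame `diag(1, B)` has an off-diagonal-free Gram matrix `ᵗc(P)·G·P`
  have hPv : P.val = Matrix.fromBlocks 1 0 0 B.val := by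
    rw [hP, coe_blockGL, Units.val_one, one_smul, one_smul]
  have hPt : (P.val.map (IsCMField.complexConj M))ᵀ =
      Matrix.fromBlocks 1 0 0 ((B.val.map (IsCMField.complexConj M))ᵀ) := by
    rw [hPv]
    simp only [Matrix.fromBlocks_map, Matrix.fromBlocks_transpose,
      Matrix.map_one (IsCMField.complexConj M) (map_zero _) (map_one _),
      Matrix.map_zero (IsCMField.complexConj M) (map_zero _), Matrix.transpose_one, Matrix.transpose_zero]
  have hG : auxGram M j H ξ₀ ξ = Matrix.fromBlocks (ξ₀ • 1) 0 0 (ξ • H.map j) := rfl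
  have hΔ : ∀ i k, i ≠ k →
      ((P.val.map (IsCMField.complexConj M))ᵀ * auxGram M j H ξ₀ ξ * P.val) i k = 0 := by
    intro i k hik
    rw [hPt, hG, hPv, Matrix.fromBlocks_multiply, Matrix.fromBlocks_multiply]
    rcases i with i | i <;> rcases k with k | k
    · exact absurd (congrArg Sum.inl (Subsingleton.elim i k)) hik
    · simp
    · simp
    · have hik' : i ≠ k := fun h => hik (congrArg Sum.inr h)
      simp [Matrix.mul_smul, hB i k hik']
  -- (2) the action `x ↦ β ∘ (P·diag(x)·P⁻¹) ∘ β⁻¹`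
  let actF : (Fin 1 ⊕ Fin 3 → M) → Module.End ℚ (Fin g ⊕ Fin g → ℚ) := fun x =>
    F.β.toLinearMap ∘ₗ (Matrix.mulVecLin (P.val * Matrix.diagonal x * (P⁻¹).val)).restrictScalars ℚ ∘ₗ F.β.symm.toLinearMap
  have actF_apply : ∀ x v, actF x v = F.β (Matrix.mulVecLin (P.val * Matrix.diagonal x * (P⁻¹).val) (F.β.symm v)) := fun _ _ => rfl
  let act : (Fin 1 ⊕ Fin 3 → M) →ₐ[ℚ] Module.End ℚ (Fin g ⊕ Fin g → ℚ) :=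
    { toFun := actF
      map_one' := by
        refine LinearMap.ext fun v => ?_
        rw [actF_apply, frameDiag_mulVecLin_one, LinearMap.id_apply, LinearEquiv.apply_symm_apply, Module.End.one_apply]
      map_mul' := fun x y => by
        refine LinearMap.ext fun v => ?_
        rw [Module.End.mul_apply, actF_apply, actF_apply, actF_apply, frameDiag_mulVecLin_mul, LinearMap.comp_apply,
          LinearEquiv.symm_apply_apply]
      map_zero' := by
        refine LinearMap.ext fun v => ?_
        rw [actF_apply, frameDiag_mulVecLin_zero, LinearMap.zero_apply, map_zero, LinearMap.zero_apply]
      map_add' := fun x y => by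
        refine LinearMap.ext fun v => ?_
        rw [LinearMap.add_apply, actF_apply, actF_apply, actF_apply, frameDiag_mulVecLin_add, LinearMap.add_apply, map_add]
      commutes' := fun r => by
        refine LinearMap.ext fun v => ?_
        have hr : (algebraMap ℚ (Fin 1 ⊕ Fin 3 → M) r) = fun _ => algebraMap ℚ M r := funext fun _ => rfl
        rw [Module.algebraMap_end_apply, actF_apply, hr, frameDiag_mulVecLin_const, algebraMap_smul, map_smul,
          LinearEquiv.apply_symm_apply] }
  have act_apply : ∀ x v, act x v = F.β (Matrix.mulVecLin (P.val * Matrix.diagonal x * (P⁻¹).val) (F.β.symm v)) := fun _ _ => rfl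
  refine ⟨{ act := act, act_injective := ?_, sum_finrank_eq := ?_, adjoint := ?_ }, ?_⟩
  · -- `act` is injective: read it on the frame vectors
    intro x y hxy
    funext p
    have h := LinearMap.congr_fun hxy (F.β (P.val *ᵥ Pi.single p 1))
    rw [act_apply, act_apply, LinearEquiv.symm_apply_apply] at h
    have hx := frameDiag_mulVecLin_apply_frameVec P x p 1
    have hy := frameDiag_mulVecLin_apply_frameVec P y p 1
    rw [one_smul, mul_one] at hx hy
    rw [hx, hy] at h
    have h' := sub_eq_zero.mpr (F.β.injective h)
    rw [← sub_smul, smul_eq_zero] at h'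
    rcases h' with h0 | h0
    · exact sub_eq_zero.mp h0
    · exact absurd h0 (frameVec_ne_zero P p)
  · -- `Σ_p [M:ℚ] = 2g`
    show ∑ _p : Fin 1 ⊕ Fin 3, Module.finrank ℚ M = 2 * g
    have hfr : Module.finrank ℚ ((Fin 1 ⊕ Fin 3) → M) = ∑ _p : Fin 1 ⊕ Fin 3, Module.finrank ℚ M :=
      Module.finrank_pi_fintype ℚ
    rw [← hfr, F.β.finrank_eq, Module.finrank_pi, Fintype.card_sum, Fintype.card_fin, two_mul]
  · -- `ψ_δ`-self-adjointness
    intro x v w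
    have key := auxForm_mulVec_eq_of_transpose_map_mul (j := j) (H := H) (ξ₀ := ξ₀) (ξ := ξ) _ _
      (transpose_map_mul_gram_eq (IsCMField.complexConj M) (auxGram M j H ξ₀ ξ) P hΔ x) (F.β.symm v) (F.β.symm w)
    rw [F.gram, F.gram, LinearEquiv.apply_symm_apply, LinearEquiv.apply_symm_apply] at key
    rw [act_apply, act_apply, Matrix.mulVecLin_apply, Matrix.mulVecLin_apply]
    exact key
  · -- the action on the frame vectors
    intro x p m
    rw [act_apply, LinearEquiv.symm_apply_apply, frameDiag_mulVecLin_apply_frameVec]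

end OrthogonalFrame

end Literature.AlgebraicGeometry.ShimuraVarieties.UnitaryCanonicalModel.Aux

end
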